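import Summits.CriticalPhenomena.Ising3DConformalLimit.Theses.GaussianScaleMixture
import Summits.CriticalPhenomena.Ising3DConformalLimit.Theses.HyperoctahedralRP
import Literature.Analysis.SpecialFunctions.IsStieltjesFunction
import Literature.MathematicalPhysics.QuantumFieldTheory.MirrorRPKernel
import Literature.MathematicalPhysics.QuantumFieldTheory.LatticeMirrorNormals
import Literature.Analysis.Complex.QuarterStripContinuation
import Literature.Analysis.Complex.StripTilingEntire
import Literature.Analysis.Complex.PeriodicEntireLiouville
import Summits.CriticalPhenomena.Ising3DConformalLimit.Theorems.GSMRigidity.Negative.ThreeAtomKernel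
import Summits.CriticalPhenomena.Ising3DConformalLimit.Theorems.GSMRigidity.Negative.SwapPencilJump
import Summits.CriticalPhenomena.Ising3DConformalLimit.Theorems.GSMRigidity.Negative.PlannerFamily

/-!
# Crux `GaussianScaleMixture.GSMRigidity` (stmt-CriticalPhenomena-8366) — skeleton of the line `momentum-one-amplitude`

Crux-plan seat `planner-cruxplan-stmt-CriticalPhenomena-8366-momentum-one-amplitu-0`, 2026-08-16, round 1.
Idea card `Cruxes/GSMRigidity/Ideas/momentum-one-amplitude.md` (ideator 2), merged by all three triagers with its twin
`one-circle-laplace-lift` (ideator 3); triage `TRIAGE-r1-{1,2,3}.md`: pass ×3, with the sharpening adopted below (S3).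
Line card: `Cruxes/GSMRigidity/Lines/momentum-one-amplitude.md`.

## The line in one screen (k-side; `a := 3/2 - Δ ∈ [1/2, 1]`, `β := 2a = 3 - 2Δ ∈ [1, 2]`)

Write `K x = ∫ e^{-s·x²} dν(s)` off the origin (the GSM conjunct of the crux).  Gaussians are Fourier self-dual, so the
DUAL MIXTURE `Ǩ_ν(k) := ∫ w(s) e^{-Σᵢ kᵢ²/(4sᵢ)} dν(s)`, `w(s) = (s₀s₁s₂)^{-1/2}` (`= π^{-3/2} K̂(k)` wherever finite) is again
a Gaussian scale mixture; on the equatorial plane `k₂ = 0` we use its squared-coordinate form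
`D_ν(u, v) := ∫ w(s) e^{-(u/(4s₀) + v/(4s₁))} dν(s)` (`u = k₀²`, `v = k₁²`) and the profile `κ(ω) := D_ν(cos²ω, sin²ω)`.
* S1 `stub_mixingMeasureStructure` (F1 of the Disproof, WLOG form): the mixing measure may be taken on the OPEN octant,
  σ-finite, EXCHANGEABLE (`S₃`-average, using the swap invariances of `K`) and `Δ`-HOMOGENEOUS
  (`(c•)_*ν = c^{-Δ} ν`, Laplace uniqueness on the open octant + homogeneity of `K`).
* S2 `stub_pencilStieltjes` (THE DICTIONARY, F2; hardest stub): reflection positivity + invariance of `K` for a unit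
  normal `n` of the plane `k₂ = 0` make every equatorial pencil `t ↦ Ǩ_ν(t n + q)` (`q ⊥ n`, `q ≠ 0`, in the plane) a
  STIELTJES function of `t²` at all its off-axis points (transverse Gaussian smearing + Plancherel, Bernstein–Widder on
  `((0,∞),+)`, `u`-Fourier transform `e^{-E|u|} ↦ 2E/(E²+t²)`, Fubini on the Gaussian representation; `Δ ≥ 1/2` gives
  finiteness of `Ǩ_ν` off the axes).  Used for the pole `e₀` (offset `e₁`) and the pole `(e₀+e₁)/√2` (offsets `c(e₁-e₀)/√2`).
* S3 `stub_dualProfileRegular` (pole finiteness + bookkeeping; the triage-sharpened step (3) of the card): the diagonal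
  pencils cross the axis `ℝ₊e₁` at `t = c`; Stieltjes–Harnack `g(s) ≤ max(1, s₀/s) g(s₀)` + monotonicity of `D_ν` in
  `(u,v)` + monotone convergence give `D_ν(0,v) < ∞` (NOT automatic for `Δ < 1`: Disproof F8(ii)'s sentence is false in
  general, cf. TRIAGE-r1-1 and r1-3), whence continuity of `κ`, its `D₄` symmetries (`π`-periodic, `κ(π-ω) = κ(ω)`,
  `κ(3π/2-ω) = κ(ω)` by exchangeability), the two pole traces `κ(γⱼ+π/2-θ) = (cos θ)^{-β} gⱼ(tan²θ)` (homogeneity of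
  `D_ν` of degree `-a` in `(u,v)`) and the power bounds `gⱼ(r²) ≤ 2^a D_ν(1,0) r^{-β}`.
* S4 `stub_stieltjesHalfPlane` (one complex variable): a Stieltjes `g` with `g(r²) ≤ M₀ r^{-β}`, `β ≥ 1`, continues to
  `F(t) = g(t²)` holomorphic on `{Re t > 0}` with `‖F t‖ ≤ M₀ (Re t)^{-β}` — the sector bound
  `|t² + E| ≥ (Re t/|t|)(|t|² + E)` and `|t|^{1-β} ≤ (Re t)^{1-β}`; THIS is where `Δ ≤ 1` (`β ≥ 1`) is used.
* `profile_const` (PROVED below, no sorry): the two-pole lemma on one circle = landed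
  `Literature.Analysis.Complex.{exists_quarterStrip_continuation, exists_tiled_continuation, exists_entire_of_two_tilings,
  apply_eq_apply_of_periodic_of_norm_le_exp}` (the x-side stubs `stub_stripTilingEntire`/`stub_periodicTypeLiouville` of
  HRP2Rigidity's line `xray-mellin-transfer`, landed): `κ` is constant (`βπ/2 < 2π ⇔ β < 4`).  Hence
  `D_ν(1,0) = D_ν(1/2,1/2)`, i.e. `Ǩ_ν(e₀) = Ǩ_ν((e₀+e₁)/√2)`: ONE AMPLITUDE IDENTITY in momentum space.
* S5 `stub_oneAmplitudeMomentum` (the card's lever = route item `OneAmplitudeIsotropy` (stmt-8369) read on `(Ǩ, ν̂)`, with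
  the endgame folded in): for exchangeable `ν` the identity reads `∫ w (e^{-A}+e^{-B})/2 = ∫ w e^{-(A+B)/2}`,
  `A = 1/(4s₀)`, `B = 1/(4s₁)`; strict convexity (AM–GM) forces `s₀ = s₁` `ν`-a.e., exchangeability `s₀ = s₁ = s₂` a.e.,
  so `K(x) = ∫ e^{-s₀‖x‖²} dν` and `K ∘ R = K`.
Composition `GSMRigidity_of : S1 → S2 → S3 → S4 → S5 → GSMRigidity` (kernel-checked, sorry-free) and
`GSMRigidity_of_stubs : GSMRigidity` (the registered stubs discharge the five hypotheses verbatim).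

## Disproof used (`Cruxes/GSMRigidity/Disproof.lean`, cycles 1–2, read 2026-08-16T02:40Z; sibling `Cruxes/HRP2Rigidity/Disproof.lean`)
* `gsmRigidity_false_without_RP` / landed `Theorems/GSMRigidity/Negative/ThreeAtomKernel.lean`
  (`not_gsmRigidity_without_RP`, `threeAtomKernel_not_swapRP`): RP is load-bearing — the line uses RP at S2 ONLY (the
  Stieltjes property of the pencils IS reflection positivity), for the normals `e₀` and `e₀+e₁` (one diagonal RP is
  load-bearing, F9(iii); the coordinate RP is free in the cone by Frank–Lieb but is used here for the `e₀`-trace).  The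
  witness `threeAtomKernel` (exchangeable GSM, `Δ = 1`, anisotropic) has `Ǩ(e₀) ≠ Ǩ((e₀+e₁)/√2)` by S5 read backwards, so
  by `profile_const` + S4 + S3 its diagonal pencil cannot be Stieltjes: consistent with `threeAtomKernel_not_swapRP` (swap
  and anti-swap mirrors are conjugate by `x₁ ↦ -x₁`).
* F8(ii) ("`K̂` finite on the axes") is NOT assumed: S2 is stated off the axes, and S3 PROVES axis finiteness from the
  diagonal RP (Harnack + monotone limit), as sharpened by TRIAGE-r1-1, r1-2, r1-3.
* F3/F8 (the disprover's swap-pencil arc proof, `SwapPencilAnalytic`/`SliceRigidity`, landed `Negative/SwapPencilJump.lean`)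
  is a DIFFERENT closing of the same crux sharing only S1 (polar/homogeneous structure) and S2 (dictionary) with this line;
  `Negative/PlannerFamily.lean`, `Negative/TwoRowSwapRP.lean` refute no stub here (every stub keeps RP among its
  hypotheses or is pure analysis / measure theory).  F4/F9(v): `Δ ≤ 1` unused there; HERE it is used, at S4 only.
* No stub restates the crux, `HRP2Rigidity`, the summit, or a refuted statement (`ledger negatives --problem
  CriticalPhenomena`, read 2026-08-16T03:04Z: 9 items, all SAW/Cardy/percolation, none kernel-level).
* Scratch check against the landed Negative lemmas: the three built modules `Theorems/GSMRigidity/Negative/{ThreeAtomKernel,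
  SwapPencilJump,PlannerFamily}.lean` are imported below and exercised in `section NegativeScratch` at the end of the file
  (`TwoRowSwapRP.lean`, p76142, was not yet built on the farm at check time).
* Remark `GSMRigidity_of_HRP2Rigidity` (proved, one line): the sibling crux stmt-1979 implies this crux verbatim; its
  x-side line `xray-mellin-transfer` is one stub (`stub_halfPlaneContinuation`) from landing (2026-08-16) — the lead
  should weigh this before investing in S2.
-/

noncomputable section

open scoped BigOperators InnerProductSpace Real
open MeasureTheory Filter Topology

namespace Summit.CriticalPhenomena.Ising3DConformalLimit.Cruxes.GSMRigidity.MomentumOneAmplitude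

/-! ## The five registered stubs (the only `sorry`s).  Statements are definition-free over Mathlib +
`Literature.Analysis.SpecialFunctions.IsStieltjesFunction` + `Literature.MathematicalPhysics.QuantumFieldTheory.IsMirrorRPKernel`;
the dual mixture is always written out: `Ǩ_ν(k) = ∫ (s₀s₁s₂)^{-1/2} exp(-Σᵢ kᵢ²/(4sᵢ)) dν`,
`D_ν(u,v) = ∫ (s₀s₁s₂)^{-1/2} exp(-(u/(4s₀) + v/(4s₁))) dν`. -/

/-- Registered stub `stub_mixingMeasureStructure` — **S1 · structure of the mixing measure (Disproof F1, WLOG form).**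
If `K` is homogeneous of degree `-2Δ` (`Δ > 0`), invariant under the nine lattice mirrors, and a Gaussian scale mixture off
the origin for SOME measure on the closed octant, then it is one for a measure `ν` carried by the OPEN octant, σ-finite,
EXCHANGEABLE and `Δ`-HOMOGENEOUS (`(c•)_*ν = c^{-Δ} ν`, `c > 0`).  Proof sketch: `S₃`-average the given measure (the swap
mirrors `eᵢ - eⱼ` make `K` permutation invariant, so the average still represents `K`); `e^{-s·u₀} ν` is finite for `u₀`
in the open octant and its Laplace transform is known on an open set, so Laplace uniqueness (Cramér–Wold: 1-D mgf on an
interval, Mathlib `Measure.ext_of_charFun` / complexMGF analyticity) identifies `(c•)_*ν` with `c^{-Δ}ν` from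
`K(√c x) = c^{-Δ} K(x)`; dilation-invariant sets (the origin, the faces `{sᵢ = 0}`) then have measure `0` or `∞`, and
`∞` is excluded by integrability at `x = eᵢ`; σ-finiteness from `ν{Σsᵢ ≤ R} ≤ e^R K(1,1,1)`.  Size M–L (the 3-variable
Laplace uniqueness is the work; shared with the pencil-arc line F6(b)).  TRUE on paper (Disproof F8(o)). -/
theorem stub_mixingMeasureStructure :
    ∀ (Δ : ℝ) (K : EuclideanSpace ℝ (Fin 3) → ℝ), 0 < Δ →
      (∀ c : ℝ, 0 < c → ∀ x, K (c • x) = c ^ (-(2 * Δ)) * K x) →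
      (∀ n : EuclideanSpace ℝ (Fin 3), (∃ i j : Fin 3, i ≠ j ∧ (n = EuclideanSpace.single i 1 ∨
          n = EuclideanSpace.single i 1 + EuclideanSpace.single j 1 ∨
          n = EuclideanSpace.single i 1 - EuclideanSpace.single j 1)) →
        ∀ x, K (((ℝ ∙ n)ᗮ).reflection x) = K x) →
      (∃ ν : MeasureTheory.Measure (Fin 3 → ℝ), ν {s | ∃ i, s i < 0} = 0 ∧
        ∀ x, x ≠ 0 → MeasureTheory.Integrable (fun s => Real.exp (-∑ i, s i * (x i) ^ 2)) ν ∧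
          K x = ∫ s, Real.exp (-∑ i, s i * (x i) ^ 2) ∂ν) →
      ∃ ν : MeasureTheory.Measure (Fin 3 → ℝ), ν {s | ∃ i, s i ≤ 0} = 0 ∧ MeasureTheory.SigmaFinite ν ∧
        (∀ σ : Equiv.Perm (Fin 3), ν.map (fun s : Fin 3 → ℝ => s ∘ σ) = ν) ∧
        (∀ c : ℝ, 0 < c → ν.map (fun s : Fin 3 → ℝ => c • s) = ENNReal.ofReal (c ^ (-Δ)) • ν) ∧
        (∀ x, x ≠ 0 → MeasureTheory.Integrable (fun s => Real.exp (-∑ i, s i * (x i) ^ 2)) ν ∧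
          K x = ∫ s, Real.exp (-∑ i, s i * (x i) ^ 2) ∂ν) := by
  sorry

/-- Registered stub `stub_pencilStieltjes` — **S2 · THE DICTIONARY (Disproof F2 / HRP F1): reflection positivity makes the
equatorial pencils of the dual mixture Stieltjes.**  Let `ν` be carried by the open octant, σ-finite and `Δ`-homogeneous
with `1/2 ≤ Δ ≤ 1`, `K = ∫ e^{-s·x²}dν` off `0`; let `n` be a UNIT vector of the plane `k₂ = 0` with `K` invariant and
reflection positive for the mirror `n^⊥`, and `q ≠ 0`, `q ⊥ n`, `q` in the plane.  Then there is a Stieltjes function `g`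
(`a/s + b + ∫ dσ(E)/(s+E)`, tree predicate `IsStieltjesFunction`) with `Ǩ_ν(t n + q) = g(t²)` — the integral converging —
at every `t > 0` for which `t n + q` is off the coordinate axes (coordinates `0` and `1` non-zero).  Proof sketch (F8(i)):
finite-point RP on the open half-space ⇒ RP for transversally Gaussian-smeared configurations (Riemann sums; `K` is
continuous at positive mirror time — continuity of GSM kernels off `0` is automatic); Plancherel in the transverse
variables (all transverse transforms of Gaussians are explicit) and localisation `|ĥ_L|² → δ_q` ⇒
`(u,u') ↦ K̃(u+u'; q)` is positive definite on `((0,∞),+)`, continuous, bounded, `→ 0` ⇒ Bernstein–Widder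
(BergChristensenRessel1984 Thm 4.6.13, not in Mathlib; or GNS + the tree's contraction-semigroup Laplace representation
used by `stub_halfPlaneContinuation` of the x-side line) ⇒ `K̃(u;q) = ∫ e^{-Eu} dμ_q(E)` ⇒ its `u`-Fourier transform
`∫ 2E/(E²+t²) dμ_q` is Stieltjes in `t²` and equals `Ǩ_ν(t n + q)` by Fubini on the Gaussian representation wherever
the latter converges; off the axes it does and is continuous (majorants `ω₂^{-1/2} ≤ ω₂^{-Δ}` at the vertices — here
`Δ ≥ 1/2` — after the radial integration, F8(ii)/card one-circle-laplace-lift (2)); the pencils of the plane are limits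
`k₂ → 0` of generic ones (finite pointwise limits of Stieltjes functions are Stieltjes, F9(i)).  Size L (hardest stub:
Bernstein–Widder + the Gaussian Plancherel bookkeeping).  TRUE on paper (F2/F8(i)(ii), audited twice; HRP TRIAGE-r1-2). -/
theorem stub_pencilStieltjes :
    ∀ (Δ : ℝ) (K : EuclideanSpace ℝ (Fin 3) → ℝ) (ν : MeasureTheory.Measure (Fin 3 → ℝ))
      (n q : EuclideanSpace ℝ (Fin 3)), 1/2 ≤ Δ → Δ ≤ 1 →
      ν {s | ∃ i, s i ≤ 0} = 0 → MeasureTheory.SigmaFinite ν →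
      (∀ c : ℝ, 0 < c → ν.map (fun s : Fin 3 → ℝ => c • s) = ENNReal.ofReal (c ^ (-Δ)) • ν) →
      (∀ x, x ≠ 0 → MeasureTheory.Integrable (fun s => Real.exp (-∑ i, s i * (x i) ^ 2)) ν ∧
          K x = ∫ s, Real.exp (-∑ i, s i * (x i) ^ 2) ∂ν) →
      ‖n‖ = 1 → n 2 = 0 → q 2 = 0 → inner ℝ q n = 0 → q ≠ 0 →
      (∀ x, K (((ℝ ∙ n)ᗮ).reflection x) = K x) →
      Literature.MathematicalPhysics.QuantumFieldTheory.IsMirrorRPKernel n K →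
      ∃ g : ℝ → ℝ, Literature.Analysis.SpecialFunctions.IsStieltjesFunction g ∧
        ∀ t : ℝ, 0 < t → (t • n + q) 0 ≠ 0 → (t • n + q) 1 ≠ 0 →
          MeasureTheory.Integrable (fun s : Fin 3 → ℝ => (s 0 * s 1 * s 2) ^ (-(1/2:ℝ)) * Real.exp (-∑ i, ((t • n + q) i) ^ 2 / (4 * s i))) ν ∧
          ∫ s, (s 0 * s 1 * s 2) ^ (-(1/2:ℝ)) * Real.exp (-∑ i, ((t • n + q) i) ^ 2 / (4 * s i)) ∂ν = g (t ^ 2) := by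
  sorry

/-- Registered stub `stub_dualProfileRegular` — **S3 · pole finiteness and the regularity/symmetry/trace/growth package of
the equatorial dual profile `κ(ω) = D_ν(cos²ω, sin²ω)`** (the card's step (3), with the triage's repair).  From S1's
structure, the window, and S2's conclusions for the pole `e₀` (offset `e₁`) and for the pole `(e₀+e₁)/√2` with every
offset `c(e₁-e₀)/√2`, `0 < c ≤ 1` (points `((t-c)/√2, (t+c)/√2, 0)`, off-axis iff `t ≠ c`), conclude: (i) `D_ν(u,v)`
converges for all `u, v ≥ 0`, `(u,v) ≠ 0` — off the axes by homogeneity `D_ν(λu,λv) = λ^{-a}D_ν(u,v)` from the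
`e₀`-pencil; ON the axis by Stieltjes–Harnack (`inv_add_le_max_mul`: `g_c(s) ≤ max(1,s₀/s) g_c(s₀)`) applied to the
diagonal pencils at `t = 1+δ/2`, `c = 1-δ/2`, `s₀ = 4`, the monotonicity of `D_ν` in `(u,v)` (`g_c(4) ≤ D_ν(1/2,2)`) and
monotone convergence `D_ν(δ²/2, 2) ↑ D_ν(0,2)`; the other axis by exchangeability; (ii) continuity of `κ` (dominated
convergence, dominator at a nearby smaller point); (iii) `κ(ω+π) = κ(ω)`, `κ(π-ω) = κ(ω)` (squares) and
`κ(3π/2-ω) = κ(ω)` (exchangeability `s₀ ↔ s₁`); (iv) Stieltjes `g₁, g₂` (those of S2 for `c = 1`, the value `g₂(1) =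
D_ν(0,2)` by continuity of both sides) with ONE constant `M₀ = 2^a D_ν(1,0)`: `gⱼ(r²) ≤ M₀ r^{-(3-2Δ)}` (monotonicity +
homogeneity), and the two pole traces `κ(0+π/2-θ) = (cos θ)^{-(3-2Δ)} g₁(tan²θ)`, `κ(π/4+π/2-θ) = (cos θ)^{-(3-2Δ)}
g₂(tan²θ)` on `(0,π/2)` (homogeneity with `λ = cos²θ`; `cos(3π/4-θ)² = (cosθ-sinθ)²/2`, `sin(3π/4-θ)² = (cosθ+sinθ)²/2`).
Size M–L (measure-theoretic bookkeeping: `Measure.map` under permutations/dilations inside Bochner integrals, monotone and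
dominated convergence).  TRUE on paper (TRIAGE-r1-1 sharpen, r1-2 (b), r1-3 §2(b)). -/
theorem stub_dualProfileRegular :
    ∀ (Δ : ℝ) (K : EuclideanSpace ℝ (Fin 3) → ℝ) (ν : MeasureTheory.Measure (Fin 3 → ℝ)),
      1/2 ≤ Δ → Δ ≤ 1 →
      ν {s | ∃ i, s i ≤ 0} = 0 → MeasureTheory.SigmaFinite ν →
      (∀ σ : Equiv.Perm (Fin 3), ν.map (fun s : Fin 3 → ℝ => s ∘ σ) = ν) →
      (∀ c : ℝ, 0 < c → ν.map (fun s : Fin 3 → ℝ => c • s) = ENNReal.ofReal (c ^ (-Δ)) • ν) →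
      (∀ x, x ≠ 0 → MeasureTheory.Integrable (fun s => Real.exp (-∑ i, s i * (x i) ^ 2)) ν ∧
          K x = ∫ s, Real.exp (-∑ i, s i * (x i) ^ 2) ∂ν) →
      (∃ g : ℝ → ℝ, Literature.Analysis.SpecialFunctions.IsStieltjesFunction g ∧
          ∀ t : ℝ, 0 < t → (t • (EuclideanSpace.single (0 : Fin 3) (1 : ℝ) : EuclideanSpace ℝ (Fin 3)) + (EuclideanSpace.single (1 : Fin 3) (1 : ℝ) : EuclideanSpace ℝ (Fin 3))) 0 ≠ 0 → (t • (EuclideanSpace.single (0 : Fin 3) (1 : ℝ) : EuclideanSpace ℝ (Fin 3)) + (EuclideanSpace.single (1 : Fin 3) (1 : ℝ) : EuclideanSpace ℝ (Fin 3))) 1 ≠ 0 →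
            MeasureTheory.Integrable (fun s : Fin 3 → ℝ => (s 0 * s 1 * s 2) ^ (-(1/2:ℝ)) * Real.exp (-∑ i, ((t • (EuclideanSpace.single (0 : Fin 3) (1 : ℝ) : EuclideanSpace ℝ (Fin 3)) + (EuclideanSpace.single (1 : Fin 3) (1 : ℝ) : EuclideanSpace ℝ (Fin 3))) i) ^ 2 / (4 * s i))) ν ∧
            ∫ s, (s 0 * s 1 * s 2) ^ (-(1/2:ℝ)) * Real.exp (-∑ i, ((t • (EuclideanSpace.single (0 : Fin 3) (1 : ℝ) : EuclideanSpace ℝ (Fin 3)) + (EuclideanSpace.single (1 : Fin 3) (1 : ℝ) : EuclideanSpace ℝ (Fin 3))) i) ^ 2 / (4 * s i)) ∂ν = g (t ^ 2)) →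
      (∀ c : ℝ, 0 < c → c ≤ 1 →
        ∃ g : ℝ → ℝ, Literature.Analysis.SpecialFunctions.IsStieltjesFunction g ∧
            ∀ t : ℝ, 0 < t → (t • ((Real.sqrt 2 / 2) • ((EuclideanSpace.single (0 : Fin 3) (1 : ℝ) : EuclideanSpace ℝ (Fin 3)) + (EuclideanSpace.single (1 : Fin 3) (1 : ℝ) : EuclideanSpace ℝ (Fin 3)))) + c • ((Real.sqrt 2 / 2) • ((EuclideanSpace.single (1 : Fin 3) (1 : ℝ) : EuclideanSpace ℝ (Fin 3)) - (EuclideanSpace.single (0 : Fin 3) (1 : ℝ) : EuclideanSpace ℝ (Fin 3))))) 0 ≠ 0 → (t • ((Real.sqrt 2 / 2) • ((EuclideanSpace.single (0 : Fin 3) (1 : ℝ) : EuclideanSpace ℝ (Fin 3)) + (EuclideanSpace.single (1 : Fin 3) (1 : ℝ) : EuclideanSpace ℝ (Fin 3)))) + c • ((Real.sqrt 2 / 2) • ((EuclideanSpace.single (1 : Fin 3) (1 : ℝ) : EuclideanSpace ℝ (Fin 3)) - (EuclideanSpace.single (0 : Fin 3) (1 : ℝ) : EuclideanSpace ℝ (Fin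 3))))) 1 ≠ 0 →
              MeasureTheory.Integrable (fun s : Fin 3 → ℝ => (s 0 * s 1 * s 2) ^ (-(1/2:ℝ)) * Real.exp (-∑ i, ((t • ((Real.sqrt 2 / 2) • ((EuclideanSpace.single (0 : Fin 3) (1 : ℝ) : EuclideanSpace ℝ (Fin 3)) + (EuclideanSpace.single (1 : Fin 3) (1 : ℝ) : EuclideanSpace ℝ (Fin 3)))) + c • ((Real.sqrt 2 / 2) • ((EuclideanSpace.single (1 : Fin 3) (1 : ℝ) : EuclideanSpace ℝ (Fin 3)) - (EuclideanSpace.single (0 : Fin 3) (1 : ℝ) : EuclideanSpace ℝ (Fin 3))))) i) ^ 2 / (4 * s i))) ν ∧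
              ∫ s, (s 0 * s 1 * s 2) ^ (-(1/2:ℝ)) * Real.exp (-∑ i, ((t • ((Real.sqrt 2 / 2) • ((EuclideanSpace.single (0 : Fin 3) (1 : ℝ) : EuclideanSpace ℝ (Fin 3)) + (EuclideanSpace.single (1 : Fin 3) (1 : ℝ) : EuclideanSpace ℝ (Fin 3)))) + c • ((Real.sqrt 2 / 2) • ((EuclideanSpace.single (1 : Fin 3) (1 : ℝ) : EuclideanSpace ℝ (Fin 3)) - (EuclideanSpace.single (0 : Fin 3) (1 : ℝ) : EuclideanSpace ℝ (Fin 3))))) i) ^ 2 / (4 * s i)) ∂ν = g (t ^ 2)) →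
      (∀ u v : ℝ, 0 ≤ u → 0 ≤ v → 0 < u + v →
          MeasureTheory.Integrable (fun s : Fin 3 → ℝ => (s 0 * s 1 * s 2) ^ (-(1/2:ℝ)) * Real.exp (-((u) / (4 * s 0) + (v) / (4 * s 1)))) ν) ∧
      Continuous (fun ω : ℝ => ∫ s, (s 0 * s 1 * s 2) ^ (-(1/2:ℝ)) * Real.exp (-((Real.cos ω ^ 2) / (4 * s 0) + (Real.sin ω ^ 2) / (4 * s 1))) ∂ν) ∧
      (∀ ω : ℝ, ∫ s, (s 0 * s 1 * s 2) ^ (-(1/2:ℝ)) * Real.exp (-((Real.cos (ω + Real.pi) ^ 2) / (4 * s 0) + (Real.sin (ω + Real.pi) ^ 2) / (4 * s 1))) ∂ν =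
        ∫ s, (s 0 * s 1 * s 2) ^ (-(1/2:ℝ)) * Real.exp (-((Real.cos ω ^ 2) / (4 * s 0) + (Real.sin ω ^ 2) / (4 * s 1))) ∂ν) ∧
      (∀ ω : ℝ, ∫ s, (s 0 * s 1 * s 2) ^ (-(1/2:ℝ)) * Real.exp (-((Real.cos (2 * 0 + Real.pi - ω) ^ 2) / (4 * s 0) + (Real.sin (2 * 0 + Real.pi - ω) ^ 2) / (4 * s 1))) ∂ν =
        ∫ s, (s 0 * s 1 * s 2) ^ (-(1/2:ℝ)) * Real.exp (-((Real.cos ω ^ 2) / (4 * s 0) + (Real.sin ω ^ 2) / (4 * s 1))) ∂ν) ∧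
      (∀ ω : ℝ, ∫ s, (s 0 * s 1 * s 2) ^ (-(1/2:ℝ)) * Real.exp (-((Real.cos (2 * (Real.pi / 4) + Real.pi - ω) ^ 2) / (4 * s 0) + (Real.sin (2 * (Real.pi / 4) + Real.pi - ω) ^ 2) / (4 * s 1))) ∂ν =
        ∫ s, (s 0 * s 1 * s 2) ^ (-(1/2:ℝ)) * Real.exp (-((Real.cos ω ^ 2) / (4 * s 0) + (Real.sin ω ^ 2) / (4 * s 1))) ∂ν) ∧
      ∃ g₁ g₂ : ℝ → ℝ, Literature.Analysis.SpecialFunctions.IsStieltjesFunction g₁ ∧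
        Literature.Analysis.SpecialFunctions.IsStieltjesFunction g₂ ∧
        (∃ M₀ : ℝ, ∀ r : ℝ, 0 < r →
          g₁ (r ^ 2) ≤ M₀ * r ^ (-(3 - 2 * Δ)) ∧ g₂ (r ^ 2) ≤ M₀ * r ^ (-(3 - 2 * Δ))) ∧
        (∀ θ : ℝ, 0 < θ → θ < Real.pi / 2 →
          ∫ s, (s 0 * s 1 * s 2) ^ (-(1/2:ℝ)) * Real.exp (-((Real.cos (0 + Real.pi / 2 - θ) ^ 2) / (4 * s 0) + (Real.sin (0 + Real.pi / 2 - θ) ^ 2) / (4 * s 1))) ∂ν =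
            Real.cos θ ^ (-(3 - 2 * Δ)) * g₁ (Real.tan θ ^ 2)) ∧
        (∀ θ : ℝ, 0 < θ → θ < Real.pi / 2 →
          ∫ s, (s 0 * s 1 * s 2) ^ (-(1/2:ℝ)) * Real.exp (-((Real.cos (Real.pi / 4 + Real.pi / 2 - θ) ^ 2) / (4 * s 0) + (Real.sin (Real.pi / 4 + Real.pi / 2 - θ) ^ 2) / (4 * s 1))) ∂ν =
            Real.cos θ ^ (-(3 - 2 * Δ)) * g₂ (Real.tan θ ^ 2)) := by
  sorry

/-- Registered stub `stub_stieltjesHalfPlane` — **S4 · a Stieltjes pencil with power decay continues to the right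
half-plane in `t = √s` with the SAME power bound in `Re t` (the card's `stieltjes_sector_bound`, put to use).**  If
`g(s) = a/s + b + ∫ dσ(E)/(s+E)` is Stieltjes and `g(r²) ≤ M₀ r^{-β}` for `r > 0` with `β ≥ 1`, then
`F(t) := a/t² + b + ∫ dσ(E)/(t²+E)` is holomorphic on `{Re t > 0}` (parametric integral, local domination by
`max(1,|t|⁻²)(1+E)⁻¹`-type bounds), `F(t) = g(t²)` for `t > 0`, and `‖F t‖ ≤ M₀ (Re t)^{-β}`: termwise
`|t² + E| ≥ (Re t/|t|)(|t|² + E)` (square both sides: the difference is `(1 - cos 2φ)(|t|²-E)²/2 ≥ 0`, `φ = arg t`),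
so `‖F t‖ ≤ (|t|/Re t) g(|t|²) ≤ M₀ |t|^{1-β}/Re t ≤ M₀ (Re t)^{-β}` because `|t| ≥ Re t` and `1 - β ≤ 0`.  (For the
line `β = 3 - 2Δ`, so `β ≥ 1 ⇔ Δ ≤ 1`: the upper end of the window is used exactly here; `b = 0` and, for `β < 2`,
`a = 0` are forced by the decay but not needed.)  Size M (pure one-variable analysis over `IsStieltjesFunction`'s
representation).  TRUE (TRIAGE-r1-1, r1-2, r1-3 checked the sector bound). -/
theorem stub_stieltjesHalfPlane :
    ∀ (g : ℝ → ℝ) (β M₀ : ℝ), Literature.Analysis.SpecialFunctions.IsStieltjesFunction g → 1 ≤ β →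
      (∀ r : ℝ, 0 < r → g (r ^ 2) ≤ M₀ * r ^ (-β)) →
      ∃ F : ℂ → ℂ, DifferentiableOn ℂ F {t : ℂ | 0 < t.re} ∧
        (∀ t : ℝ, 0 < t → F t = ((g (t ^ 2) : ℝ) : ℂ)) ∧
        ∀ t : ℂ, 0 < t.re → ‖F t‖ ≤ M₀ * t.re ^ (-β) := by
  sorry

/-- Registered stub `stub_oneAmplitudeMomentum` — **S5 · "O(3) from one amplitude", momentum form (the card's lever: route
item `OneAmplitudeIsotropy`, stmt-8369, transported to `(Ǩ, ν̂)`, with the radial endgame folded in).**  Let `ν` be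
carried by the open octant and exchangeable, `K = ∫e^{-s·x²}dν` off `0`, and suppose the two dual amplitudes
`D_ν(1,0) = Ǩ_ν(e₀) = ∫ w e^{-1/(4s₀)} dν` and `D_ν(1/2,1/2) = Ǩ_ν((e₀+e₁)/√2) = ∫ w e^{-(1/(4s₀)+1/(4s₁))/2} dν`
(`w = (s₀s₁s₂)^{-1/2} > 0` a.e.) converge and are EQUAL.  Then `K (R x) = K x` for every linear isometry `R` and every
`x`.  Proof sketch: by exchangeability `∫ w e^{-A} = ∫ w (e^{-A}+e^{-B})/2` (`A = 1/(4s₀)`, `B = 1/(4s₁)`), and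
`(e^{-A}+e^{-B})/2 - e^{-(A+B)/2} ≥ 0` with equality iff `A = B` (AM–GM / strict convexity of `exp`); a non-negative
function with integral `0` vanishes a.e., so `s₀ = s₁` `ν`-a.e., hence (exchangeability) `s₀ = s₁ = s₂` a.e., the GSM
integrand is a.e. `e^{-s₀ Σxᵢ²} = e^{-s₀‖x‖²}`, `K x` depends on `‖x‖` only for `x ≠ 0`, and `R 0 = 0`.  Size M
(measure theory: `Measure.map` by a transposition, `integral_eq_zero_iff_of_nonneg`, `ae` bookkeeping).  TRUE
(card first lemma `weighted_oneAmplitude_momentum`, checked by all three triagers; this is where the GSM hypothesis is spent). -/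
theorem stub_oneAmplitudeMomentum :
    ∀ (K : EuclideanSpace ℝ (Fin 3) → ℝ) (ν : MeasureTheory.Measure (Fin 3 → ℝ)),
      ν {s | ∃ i, s i ≤ 0} = 0 →
      (∀ σ : Equiv.Perm (Fin 3), ν.map (fun s : Fin 3 → ℝ => s ∘ σ) = ν) →
      (∀ x, x ≠ 0 → MeasureTheory.Integrable (fun s => Real.exp (-∑ i, s i * (x i) ^ 2)) ν ∧
          K x = ∫ s, Real.exp (-∑ i, s i * (x i) ^ 2) ∂ν) →
      MeasureTheory.Integrable (fun s : Fin 3 → ℝ => (s 0 * s 1 * s 2) ^ (-(1/2:ℝ)) * Real.exp (-(((1:ℝ)) / (4 * s 0) + ((0:ℝ)) / (4 * s 1)))) ν →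
      MeasureTheory.Integrable (fun s : Fin 3 → ℝ => (s 0 * s 1 * s 2) ^ (-(1/2:ℝ)) * Real.exp (-(((1/2:ℝ)) / (4 * s 0) + ((1/2:ℝ)) / (4 * s 1)))) ν →
      ∫ s, (s 0 * s 1 * s 2) ^ (-(1/2:ℝ)) * Real.exp (-(((1:ℝ)) / (4 * s 0) + ((0:ℝ)) / (4 * s 1))) ∂ν =
        ∫ s, (s 0 * s 1 * s 2) ^ (-(1/2:ℝ)) * Real.exp (-(((1/2:ℝ)) / (4 * s 0) + ((1/2:ℝ)) / (4 * s 1))) ∂ν →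
      ∀ (R : EuclideanSpace ℝ (Fin 3) ≃ₗᵢ[ℝ] EuclideanSpace ℝ (Fin 3)) (x : EuclideanSpace ℝ (Fin 3)), K (R x) = K x := by
  sorry

/-! ## The two-pole lemma on one great circle — PROVED here from landed Literature theorems

This is the "rigid equator" of the idea card (HRP2Rigidity Disproof F2, restricted to one circle),
in the abstract form shared with the x-side lines `xray-mellin-transfer` (stmt-1979) and
`entire-profile-null-growth` (stmt-4800): their registered stubs `stub_stripTilingEntire` and
`stub_periodicTypeLiouville` are LANDED (`Literature.Analysis.Complex.exists_quarterStrip_continuation`,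
`exists_tiled_continuation`, `exists_entire_of_two_tilings`, `apply_eq_apply_of_periodic_of_norm_le_exp`),
so on this line the two-pole lemma is no longer a stub: a continuous `π`-periodic profile `κ`,
symmetric about `π/2` (pole `e₀`, `γ₁ = 0`) and about `3π/4` (pole `(e₀+e₁)/√2`, `γ₂ = π/4`), whose two
pole traces `κ(γⱼ + π/2 - θ) = (cos θ)^{-β} Fⱼ(tan θ)` come from right-half-plane holomorphic `Fⱼ` with
`‖Fⱼ t‖ ≤ C (Re t)^{-β}`, `0 ≤ β < 4`, is CONSTANT (the two symmetries compose to the quarter turn,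
`T = π/2`, `βT < 2π ⇔ β < 4`). On the k-side `β = 2a = 3 - 2Δ ∈ [1, 2]`. -/

/-- `π/4 ∉ (π/2)ℤ` (the two wall lattices `Re ω ∈ (π/2)ℤ` and `π/4 + (π/2)ℤ` are disjoint). -/
theorem pi_div_four_sub_zero_ne (m : ℤ) : Real.pi / 4 - 0 ≠ (m : ℝ) * (Real.pi / 2) := by
  intro hm
  have h1 : ((1 : ℝ) - 2 * m) * Real.pi = 0 := by linear_combination 4 * hm
  have h2 : (1 : ℝ) - 2 * m = 0 := (mul_eq_zero.1 h1).resolve_right Real.pi_ne_zero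
  have h3 : (1 : ℤ) = 2 * m := by exact_mod_cast (by linarith : (1 : ℝ) = 2 * m)
  omega

open Literature.Analysis.Complex in
/-- **Two-pole lemma on one circle (rigid equator), abstract form.** A continuous `π`-periodic
profile `κ : ℝ → ℝ`, symmetric about `π/2` and about `3π/4`, whose traces
`κ (0 + π/2 - θ) = (cos θ)^{-β} F₁ (tan θ)` and `κ (π/4 + π/2 - θ) = (cos θ)^{-β} F₂ (tan θ)`
(`0 < θ < π/2`) come from functions `F₁, F₂` holomorphic on `{Re t > 0}` with
`‖Fⱼ t‖ ≤ C (Re t)^{-β}`, `0 ≤ β < 4`, is constant. Proof: strip tiling along the two disjoint wall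
lattices and gluing (`exists_quarterStrip_continuation`, `exists_tiled_continuation`,
`exists_entire_of_two_tilings`) give an entire `G` of exponential type `≤ β` with `G = κ` on `ℝ`; the
two symmetries compose to `κ (ω + π/2) = κ ω`, which propagates to `G` by the identity theorem; the
periodic Liouville theorem `apply_eq_apply_of_periodic_of_norm_le_exp` with `T = π/2` (`βπ/2 < 2π`)
makes `G` constant. [folklore; HRP2Rigidity Disproof F2; cards bounded-phase-quadric-liouville,
one-circle-laplace-lift, momentum-one-amplitude] -/
theorem profile_const (κ : ℝ → ℝ) (β C : ℝ) (F₁ F₂ : ℂ → ℂ) (hβ : 0 ≤ β) (hβ4 : β < 4)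
    (hκc : Continuous κ) (hπ : ∀ ω, κ (ω + Real.pi) = κ ω)
    (hs1 : ∀ ω, κ (2 * 0 + Real.pi - ω) = κ ω)
    (hs2 : ∀ ω, κ (2 * (Real.pi / 4) + Real.pi - ω) = κ ω)
    (hF₁ : DifferentiableOn ℂ F₁ {t : ℂ | 0 < t.re}) (hF₂ : DifferentiableOn ℂ F₂ {t : ℂ | 0 < t.re})
    (hb₁ : ∀ t : ℂ, 0 < t.re → ‖F₁ t‖ ≤ C * t.re ^ (-β))
    (hb₂ : ∀ t : ℂ, 0 < t.re → ‖F₂ t‖ ≤ C * t.re ^ (-β))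
    (htr₁ : ∀ θ : ℝ, 0 < θ → θ < Real.pi / 2 →
      ((κ (0 + Real.pi / 2 - θ) : ℝ) : ℂ) = ((Real.cos θ ^ (-β) : ℝ) : ℂ) * F₁ ((Real.tan θ : ℝ) : ℂ))
    (htr₂ : ∀ θ : ℝ, 0 < θ → θ < Real.pi / 2 →
      ((κ (Real.pi / 4 + Real.pi / 2 - θ) : ℝ) : ℂ) = ((Real.cos θ ^ (-β) : ℝ) : ℂ) * F₂ ((Real.tan θ : ℝ) : ℂ)) :
    ∀ ω ω' : ℝ, κ ω = κ ω' := by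
  have _hκ := hκc
  -- `C ≥ 0`: the right half-plane is nonempty
  have hC : 0 ≤ C := by
    have h := hb₁ 1 (by simp)
    simp only [Complex.one_re, Real.one_rpow, mul_one] at h
    exact (norm_nonneg _).trans h
  -- Step 1: the quarter-strip continuations `Φⱼ(θ) = (cos θ)^{-β} Fⱼ(tan θ)`
  obtain ⟨Φ₁, hΦ₁d, hΦ₁r, hΦ₁g⟩ := exists_quarterStrip_continuation hβ hF₁ hb₁
  obtain ⟨Φ₂, hΦ₂d, hΦ₂r, hΦ₂g⟩ := exists_quarterStrip_continuation hβ hF₂ hb₂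
  have hΦ₁κ : ∀ θ : ℝ, 0 < θ → θ < π / 2 → Φ₁ θ = κ (0 + π / 2 - θ) := fun θ h1 h2 => by
    rw [hΦ₁r θ h1 h2, htr₁ θ h1 h2]
  have hΦ₂κ : ∀ θ : ℝ, 0 < θ → θ < π / 2 → Φ₂ θ = κ (π / 4 + π / 2 - θ) := fun θ h1 h2 => by
    rw [hΦ₂r θ h1 h2, htr₂ θ h1 h2]
  -- Step 2: tile each wall lattice (`γ₁ = 0`, `γ₂ = π/4`)
  obtain ⟨A₁, hd₁, hr₁, hbd₁⟩ :=
    exists_tiled_continuation (κ := κ) (γ := 0) hβ hC hπ hs1 hΦ₁d hΦ₁κ hΦ₁g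
  obtain ⟨A₂, hd₂, hr₂, hbd₂⟩ :=
    exists_tiled_continuation (κ := κ) (γ := π / 4) hβ hC hπ hs2 hΦ₂d hΦ₂κ hΦ₂g
  -- Step 3: glue the two tilings into an entire function of exponential type `β`
  obtain ⟨G, hGd, hGκ, C', hGle⟩ :=
    exists_entire_of_two_tilings hβ hC pi_div_four_sub_zero_ne hd₁ hr₁ hbd₁ hd₂ hr₂ hbd₂
  -- the two symmetries compose to the quarter turn `κ (ω + π/2) = κ ω`, hence for `G` on `ℂ`
  have hκq : ∀ ω : ℝ, κ (ω + Real.pi / 2) = κ ω := fun ω => by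
    have h1 := hs2 (Real.pi - ω)
    have h2 := hs1 ω
    rw [show 2 * (Real.pi / 4) + Real.pi - (Real.pi - ω) = ω + Real.pi / 2 by ring] at h1
    rw [show (2 : ℝ) * 0 + Real.pi - ω = Real.pi - ω by ring] at h2
    rw [h1, h2]
  have hGq : ∀ ω : ℂ, G (ω + ((Real.pi / 2 : ℝ) : ℂ)) = G ω := by
    have hident : (fun ω => G (ω + ((Real.pi / 2 : ℝ) : ℂ))) = G := by
      refine AnalyticOnNhd.eq_of_frequently_eq (z₀ := (0 : ℂ))
        (Complex.analyticOnNhd_univ_iff_differentiable.2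
          (hGd.comp (differentiable_id.add (differentiable_const _))))
        (Complex.analyticOnNhd_univ_iff_differentiable.2 hGd) ?_
      have ht : Tendsto (fun w : ℝ => (w : ℂ)) (𝓝[≠] 0) (𝓝[≠] 0) := by
        refine tendsto_nhdsWithin_of_tendsto_nhds_of_eventually_within _
          ((Complex.continuous_ofReal.tendsto' 0 0 (by simp)).mono_left nhdsWithin_le_nhds) ?_
        filter_upwards [self_mem_nhdsWithin] with w hw
        simpa using hw
      refine ht.frequently (Filter.Eventually.of_forall fun w => ?_).frequently
      show G ((w : ℂ) + ((Real.pi / 2 : ℝ) : ℂ)) = G w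
      rw [← Complex.ofReal_add, hGκ, hGκ, hκq]
    exact fun ω => congrFun hident ω
  -- Step 4: periodic Liouville with `T = π/2` (`β π/2 < 2π ⇔ β < 4`)
  have hT : β * (Real.pi / 2) < 2 * Real.pi := by
    have := mul_lt_mul_of_pos_right hβ4 (half_pos Real.pi_pos)
    linarith
  have hconst := apply_eq_apply_of_periodic_of_norm_le_exp (half_pos Real.pi_pos) hT hGd hGq hGle
  intro ω ω'
  have h := hconst (ω : ℂ) (ω' : ℂ)
  rw [hGκ, hGκ, Complex.ofReal_inj] at h
  exact h

/-! ## Small Euclidean bookkeeping for the two poles `e₀` and `(e₀+e₁)/√2` of the circle `{k₂ = 0}` -/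

open Literature.MathematicalPhysics.QuantumFieldTheory

theorem norm_e0 : ‖(EuclideanSpace.single (0 : Fin 3) (1 : ℝ) : EuclideanSpace ℝ (Fin 3))‖ = 1 := by simp

theorem e0_apply_two : ((EuclideanSpace.single (0 : Fin 3) (1 : ℝ) : EuclideanSpace ℝ (Fin 3))) 2 = 0 := by simp

theorem e1_apply_two : ((EuclideanSpace.single (1 : Fin 3) (1 : ℝ) : EuclideanSpace ℝ (Fin 3))) 2 = 0 := by simp

theorem inner_e1_e0 : inner ℝ ((EuclideanSpace.single (1 : Fin 3) (1 : ℝ) : EuclideanSpace ℝ (Fin 3))) ((EuclideanSpace.single (0 : Fin 3) (1 : ℝ) : EuclideanSpace ℝ (Fin 3))) = 0 := by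
  rw [inner_single_one_left]; simp

theorem e1_ne_zero : ((EuclideanSpace.single (1 : Fin 3) (1 : ℝ) : EuclideanSpace ℝ (Fin 3))) ≠ 0 := by
  intro h
  have := congrArg (fun v : EuclideanSpace ℝ (Fin 3) => v 1) h
  simp at this

theorem norm_e0_add_e1 : ‖(EuclideanSpace.single (0 : Fin 3) (1 : ℝ) : EuclideanSpace ℝ (Fin 3)) + (EuclideanSpace.single (1 : Fin 3) (1 : ℝ) : EuclideanSpace ℝ (Fin 3))‖ = Real.sqrt 2 := by
  have h : ‖(EuclideanSpace.single (0 : Fin 3) (1 : ℝ) : EuclideanSpace ℝ (Fin 3)) + (EuclideanSpace.single (1 : Fin 3) (1 : ℝ) : EuclideanSpace ℝ (Fin 3))‖ ^ 2 = 2 := by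
    rw [← real_inner_self_eq_norm_sq, inner_add_left, inner_single_one_left, inner_single_one_left]
    simp
    norm_num
  rw [← Real.sqrt_sq (norm_nonneg ((EuclideanSpace.single (0 : Fin 3) (1 : ℝ) : EuclideanSpace ℝ (Fin 3)) + (EuclideanSpace.single (1 : Fin 3) (1 : ℝ) : EuclideanSpace ℝ (Fin 3)))), h]

theorem sqrt_two_div_two_pos : (0 : ℝ) < Real.sqrt 2 / 2 := by positivity

theorem norm_diagPole : ‖(Real.sqrt 2 / 2) • ((EuclideanSpace.single (0 : Fin 3) (1 : ℝ) : EuclideanSpace ℝ (Fin 3)) + (EuclideanSpace.single (1 : Fin 3) (1 : ℝ) : EuclideanSpace ℝ (Fin 3)))‖ = 1 := by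
  rw [norm_smul, norm_e0_add_e1, Real.norm_eq_abs, abs_of_pos sqrt_two_div_two_pos,
    div_mul_eq_mul_div, Real.mul_self_sqrt (by norm_num : (0:ℝ) ≤ 2)]
  norm_num

theorem diagPole_apply_two : ((Real.sqrt 2 / 2) • ((EuclideanSpace.single (0 : Fin 3) (1 : ℝ) : EuclideanSpace ℝ (Fin 3)) + (EuclideanSpace.single (1 : Fin 3) (1 : ℝ) : EuclideanSpace ℝ (Fin 3)))) 2 = 0 := by simp

theorem diagOffset_apply_two (c : ℝ) : (c • ((Real.sqrt 2 / 2) • ((EuclideanSpace.single (1 : Fin 3) (1 : ℝ) : EuclideanSpace ℝ (Fin 3)) - (EuclideanSpace.single (0 : Fin 3) (1 : ℝ) : EuclideanSpace ℝ (Fin 3))))) 2 = 0 := by simp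

theorem inner_diagOffset_diagPole (c : ℝ) :
    inner ℝ (c • ((Real.sqrt 2 / 2) • ((EuclideanSpace.single (1 : Fin 3) (1 : ℝ) : EuclideanSpace ℝ (Fin 3)) - (EuclideanSpace.single (0 : Fin 3) (1 : ℝ) : EuclideanSpace ℝ (Fin 3))))) ((Real.sqrt 2 / 2) • ((EuclideanSpace.single (0 : Fin 3) (1 : ℝ) : EuclideanSpace ℝ (Fin 3)) + (EuclideanSpace.single (1 : Fin 3) (1 : ℝ) : EuclideanSpace ℝ (Fin 3)))) = 0 := by
  rw [real_inner_smul_left, real_inner_smul_left, real_inner_smul_right, inner_sub_left,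
    inner_single_one_left, inner_single_one_left]
  simp

theorem diagOffset_ne_zero {c : ℝ} (hc : 0 < c) : c • ((Real.sqrt 2 / 2) • ((EuclideanSpace.single (1 : Fin 3) (1 : ℝ) : EuclideanSpace ℝ (Fin 3)) - (EuclideanSpace.single (0 : Fin 3) (1 : ℝ) : EuclideanSpace ℝ (Fin 3)))) ≠ 0 := by
  intro h
  have h1 := congrArg (fun v : EuclideanSpace ℝ (Fin 3) => v 1) h
  simp at h1
  linarith [Real.sqrt_pos.2 (show (0:ℝ) < 2 by norm_num)]

theorem cos_zero_sq : Real.cos 0 ^ 2 = (1 : ℝ) := by rw [Real.cos_zero, one_pow]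
theorem sin_zero_sq : Real.sin 0 ^ 2 = (0 : ℝ) := by rw [Real.sin_zero]; ring
theorem cos_pi_div_four_sq : Real.cos (Real.pi / 4) ^ 2 = (1 / 2 : ℝ) := by
  rw [Real.cos_pi_div_four, div_pow, Real.sq_sqrt (by norm_num : (0:ℝ) ≤ 2)]; norm_num
theorem sin_pi_div_four_sq : Real.sin (Real.pi / 4) ^ 2 = (1 / 2 : ℝ) := by
  rw [Real.sin_pi_div_four, div_pow, Real.sq_sqrt (by norm_num : (0:ℝ) ≤ 2)]; norm_num

/-! ## The composition (kernel-checked, no `sorry` of its own): the five stubs prove the crux BY NAME -/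

/-- **`GSMRigidity` from the five stubs of the line `momentum-one-amplitude`.**
S1 structures the mixing measure (exchangeable, `Δ`-homogeneous, open octant); S2 (the dictionary,
applied to the coordinate pole `e₀` with offset `e₁` and to the diagonal pole `(e₀+e₁)/√2` with the
offsets `c (e₁-e₀)/√2`, `0 < c ≤ 1`, using the invariance + RP conjuncts of the crux for the normals
`e₀` and `e₀ + e₁`) makes the equatorial pencils of the dual mixture Stieltjes; S3 turns this into
pole finiteness, continuity, the `D₄` symmetries, the two traces and the power bounds of the
equatorial profile `κ(ω) = D_ν(cos²ω, sin²ω)`; S4 continues the two pole pencils to the right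
half-plane with the bound `M₀ (Re t)^{-(3-2Δ)}`; `profile_const` (proved above) makes `κ` constant,
in particular `D_ν(1,0) = D_ν(1/2,1/2)` — the momentum one-amplitude identity `Ǩ(e₀) = Ǩ((e₀+e₁)/√2)`;
S5 (strict convexity + exchangeability) concludes `K ∘ R = K`. -/
theorem GSMRigidity_of :
    (∀ (Δ : ℝ) (K : EuclideanSpace ℝ (Fin 3) → ℝ), 0 < Δ →
      (∀ c : ℝ, 0 < c → ∀ x, K (c • x) = c ^ (-(2 * Δ)) * K x) →
      (∀ n : EuclideanSpace ℝ (Fin 3), (∃ i j : Fin 3, i ≠ j ∧ (n = EuclideanSpace.single i 1 ∨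
          n = EuclideanSpace.single i 1 + EuclideanSpace.single j 1 ∨
          n = EuclideanSpace.single i 1 - EuclideanSpace.single j 1)) →
        ∀ x, K (((ℝ ∙ n)ᗮ).reflection x) = K x) →
      (∃ ν : MeasureTheory.Measure (Fin 3 → ℝ), ν {s | ∃ i, s i < 0} = 0 ∧
        ∀ x, x ≠ 0 → MeasureTheory.Integrable (fun s => Real.exp (-∑ i, s i * (x i) ^ 2)) ν ∧
          K x = ∫ s, Real.exp (-∑ i, s i * (x i) ^ 2) ∂ν) →
      ∃ ν : MeasureTheory.Measure (Fin 3 → ℝ), ν {s | ∃ i, s i ≤ 0} = 0 ∧ MeasureTheory.SigmaFinite ν ∧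
        (∀ σ : Equiv.Perm (Fin 3), ν.map (fun s : Fin 3 → ℝ => s ∘ σ) = ν) ∧
        (∀ c : ℝ, 0 < c → ν.map (fun s : Fin 3 → ℝ => c • s) = ENNReal.ofReal (c ^ (-Δ)) • ν) ∧
        (∀ x, x ≠ 0 → MeasureTheory.Integrable (fun s => Real.exp (-∑ i, s i * (x i) ^ 2)) ν ∧
          K x = ∫ s, Real.exp (-∑ i, s i * (x i) ^ 2) ∂ν)) →
    (∀ (Δ : ℝ) (K : EuclideanSpace ℝ (Fin 3) → ℝ) (ν : MeasureTheory.Measure (Fin 3 → ℝ))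
      (n q : EuclideanSpace ℝ (Fin 3)), 1/2 ≤ Δ → Δ ≤ 1 →
      ν {s | ∃ i, s i ≤ 0} = 0 → MeasureTheory.SigmaFinite ν →
      (∀ c : ℝ, 0 < c → ν.map (fun s : Fin 3 → ℝ => c • s) = ENNReal.ofReal (c ^ (-Δ)) • ν) →
      (∀ x, x ≠ 0 → MeasureTheory.Integrable (fun s => Real.exp (-∑ i, s i * (x i) ^ 2)) ν ∧
          K x = ∫ s, Real.exp (-∑ i, s i * (x i) ^ 2) ∂ν) →
      ‖n‖ = 1 → n 2 = 0 → q 2 = 0 → inner ℝ q n = 0 → q ≠ 0 →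
      (∀ x, K (((ℝ ∙ n)ᗮ).reflection x) = K x) →
      Literature.MathematicalPhysics.QuantumFieldTheory.IsMirrorRPKernel n K →
      ∃ g : ℝ → ℝ, Literature.Analysis.SpecialFunctions.IsStieltjesFunction g ∧
        ∀ t : ℝ, 0 < t → (t • n + q) 0 ≠ 0 → (t • n + q) 1 ≠ 0 →
          MeasureTheory.Integrable (fun s : Fin 3 → ℝ => (s 0 * s 1 * s 2) ^ (-(1/2:ℝ)) * Real.exp (-∑ i, ((t • n + q) i) ^ 2 / (4 * s i))) ν ∧
          ∫ s, (s 0 * s 1 * s 2) ^ (-(1/2:ℝ)) * Real.exp (-∑ i, ((t • n + q) i) ^ 2 / (4 * s i)) ∂ν = g (t ^ 2)) →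
    (∀ (Δ : ℝ) (K : EuclideanSpace ℝ (Fin 3) → ℝ) (ν : MeasureTheory.Measure (Fin 3 → ℝ)),
      1/2 ≤ Δ → Δ ≤ 1 →
      ν {s | ∃ i, s i ≤ 0} = 0 → MeasureTheory.SigmaFinite ν →
      (∀ σ : Equiv.Perm (Fin 3), ν.map (fun s : Fin 3 → ℝ => s ∘ σ) = ν) →
      (∀ c : ℝ, 0 < c → ν.map (fun s : Fin 3 → ℝ => c • s) = ENNReal.ofReal (c ^ (-Δ)) • ν) →
      (∀ x, x ≠ 0 → MeasureTheory.Integrable (fun s => Real.exp (-∑ i, s i * (x i) ^ 2)) ν ∧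
          K x = ∫ s, Real.exp (-∑ i, s i * (x i) ^ 2) ∂ν) →
      (∃ g : ℝ → ℝ, Literature.Analysis.SpecialFunctions.IsStieltjesFunction g ∧
          ∀ t : ℝ, 0 < t → (t • (EuclideanSpace.single (0 : Fin 3) (1 : ℝ) : EuclideanSpace ℝ (Fin 3)) + (EuclideanSpace.single (1 : Fin 3) (1 : ℝ) : EuclideanSpace ℝ (Fin 3))) 0 ≠ 0 → (t • (EuclideanSpace.single (0 : Fin 3) (1 : ℝ) : EuclideanSpace ℝ (Fin 3)) + (EuclideanSpace.single (1 : Fin 3) (1 : ℝ) : EuclideanSpace ℝ (Fin 3))) 1 ≠ 0 →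
            MeasureTheory.Integrable (fun s : Fin 3 → ℝ => (s 0 * s 1 * s 2) ^ (-(1/2:ℝ)) * Real.exp (-∑ i, ((t • (EuclideanSpace.single (0 : Fin 3) (1 : ℝ) : EuclideanSpace ℝ (Fin 3)) + (EuclideanSpace.single (1 : Fin 3) (1 : ℝ) : EuclideanSpace ℝ (Fin 3))) i) ^ 2 / (4 * s i))) ν ∧
            ∫ s, (s 0 * s 1 * s 2) ^ (-(1/2:ℝ)) * Real.exp (-∑ i, ((t • (EuclideanSpace.single (0 : Fin 3) (1 : ℝ) : EuclideanSpace ℝ (Fin 3)) + (EuclideanSpace.single (1 : Fin 3) (1 : ℝ) : EuclideanSpace ℝ (Fin 3))) i) ^ 2 / (4 * s i)) ∂ν = g (t ^ 2)) →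
      (∀ c : ℝ, 0 < c → c ≤ 1 →
        ∃ g : ℝ → ℝ, Literature.Analysis.SpecialFunctions.IsStieltjesFunction g ∧
            ∀ t : ℝ, 0 < t → (t • ((Real.sqrt 2 / 2) • ((EuclideanSpace.single (0 : Fin 3) (1 : ℝ) : EuclideanSpace ℝ (Fin 3)) + (EuclideanSpace.single (1 : Fin 3) (1 : ℝ) : EuclideanSpace ℝ (Fin 3)))) + c • ((Real.sqrt 2 / 2) • ((EuclideanSpace.single (1 : Fin 3) (1 : ℝ) : EuclideanSpace ℝ (Fin 3)) - (EuclideanSpace.single (0 : Fin 3) (1 : ℝ) : EuclideanSpace ℝ (Fin 3))))) 0 ≠ 0 → (t • ((Real.sqrt 2 / 2) • ((EuclideanSpace.single (0 : Fin 3) (1 : ℝ) : EuclideanSpace ℝ (Fin 3)) + (EuclideanSpace.single (1 : Fin 3) (1 : ℝ) : EuclideanSpace ℝ (Fin 3)))) + c • ((Real.sqrt 2 / 2) • ((EuclideanSpace.single (1 : Fin 3) (1 : ℝ) : EuclideanSpace ℝ (Fin 3)) - (EuclideanSpace.single (0 : Fin 3) (1 : ℝ) : EuclideanSpace ℝ (Fin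 3))))) 1 ≠ 0 →
              MeasureTheory.Integrable (fun s : Fin 3 → ℝ => (s 0 * s 1 * s 2) ^ (-(1/2:ℝ)) * Real.exp (-∑ i, ((t • ((Real.sqrt 2 / 2) • ((EuclideanSpace.single (0 : Fin 3) (1 : ℝ) : EuclideanSpace ℝ (Fin 3)) + (EuclideanSpace.single (1 : Fin 3) (1 : ℝ) : EuclideanSpace ℝ (Fin 3)))) + c • ((Real.sqrt 2 / 2) • ((EuclideanSpace.single (1 : Fin 3) (1 : ℝ) : EuclideanSpace ℝ (Fin 3)) - (EuclideanSpace.single (0 : Fin 3) (1 : ℝ) : EuclideanSpace ℝ (Fin 3))))) i) ^ 2 / (4 * s i))) ν ∧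
              ∫ s, (s 0 * s 1 * s 2) ^ (-(1/2:ℝ)) * Real.exp (-∑ i, ((t • ((Real.sqrt 2 / 2) • ((EuclideanSpace.single (0 : Fin 3) (1 : ℝ) : EuclideanSpace ℝ (Fin 3)) + (EuclideanSpace.single (1 : Fin 3) (1 : ℝ) : EuclideanSpace ℝ (Fin 3)))) + c • ((Real.sqrt 2 / 2) • ((EuclideanSpace.single (1 : Fin 3) (1 : ℝ) : EuclideanSpace ℝ (Fin 3)) - (EuclideanSpace.single (0 : Fin 3) (1 : ℝ) : EuclideanSpace ℝ (Fin 3))))) i) ^ 2 / (4 * s i)) ∂ν = g (t ^ 2)) →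
      (∀ u v : ℝ, 0 ≤ u → 0 ≤ v → 0 < u + v →
          MeasureTheory.Integrable (fun s : Fin 3 → ℝ => (s 0 * s 1 * s 2) ^ (-(1/2:ℝ)) * Real.exp (-((u) / (4 * s 0) + (v) / (4 * s 1)))) ν) ∧
      Continuous (fun ω : ℝ => ∫ s, (s 0 * s 1 * s 2) ^ (-(1/2:ℝ)) * Real.exp (-((Real.cos ω ^ 2) / (4 * s 0) + (Real.sin ω ^ 2) / (4 * s 1))) ∂ν) ∧
      (∀ ω : ℝ, ∫ s, (s 0 * s 1 * s 2) ^ (-(1/2:ℝ)) * Real.exp (-((Real.cos (ω + Real.pi) ^ 2) / (4 * s 0) + (Real.sin (ω + Real.pi) ^ 2) / (4 * s 1))) ∂ν =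
        ∫ s, (s 0 * s 1 * s 2) ^ (-(1/2:ℝ)) * Real.exp (-((Real.cos ω ^ 2) / (4 * s 0) + (Real.sin ω ^ 2) / (4 * s 1))) ∂ν) ∧
      (∀ ω : ℝ, ∫ s, (s 0 * s 1 * s 2) ^ (-(1/2:ℝ)) * Real.exp (-((Real.cos (2 * 0 + Real.pi - ω) ^ 2) / (4 * s 0) + (Real.sin (2 * 0 + Real.pi - ω) ^ 2) / (4 * s 1))) ∂ν =
        ∫ s, (s 0 * s 1 * s 2) ^ (-(1/2:ℝ)) * Real.exp (-((Real.cos ω ^ 2) / (4 * s 0) + (Real.sin ω ^ 2) / (4 * s 1))) ∂ν) ∧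
      (∀ ω : ℝ, ∫ s, (s 0 * s 1 * s 2) ^ (-(1/2:ℝ)) * Real.exp (-((Real.cos (2 * (Real.pi / 4) + Real.pi - ω) ^ 2) / (4 * s 0) + (Real.sin (2 * (Real.pi / 4) + Real.pi - ω) ^ 2) / (4 * s 1))) ∂ν =
        ∫ s, (s 0 * s 1 * s 2) ^ (-(1/2:ℝ)) * Real.exp (-((Real.cos ω ^ 2) / (4 * s 0) + (Real.sin ω ^ 2) / (4 * s 1))) ∂ν) ∧
      ∃ g₁ g₂ : ℝ → ℝ, Literature.Analysis.SpecialFunctions.IsStieltjesFunction g₁ ∧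
        Literature.Analysis.SpecialFunctions.IsStieltjesFunction g₂ ∧
        (∃ M₀ : ℝ, ∀ r : ℝ, 0 < r →
          g₁ (r ^ 2) ≤ M₀ * r ^ (-(3 - 2 * Δ)) ∧ g₂ (r ^ 2) ≤ M₀ * r ^ (-(3 - 2 * Δ))) ∧
        (∀ θ : ℝ, 0 < θ → θ < Real.pi / 2 →
          ∫ s, (s 0 * s 1 * s 2) ^ (-(1/2:ℝ)) * Real.exp (-((Real.cos (0 + Real.pi / 2 - θ) ^ 2) / (4 * s 0) + (Real.sin (0 + Real.pi / 2 - θ) ^ 2) / (4 * s 1))) ∂ν =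
            Real.cos θ ^ (-(3 - 2 * Δ)) * g₁ (Real.tan θ ^ 2)) ∧
        (∀ θ : ℝ, 0 < θ → θ < Real.pi / 2 →
          ∫ s, (s 0 * s 1 * s 2) ^ (-(1/2:ℝ)) * Real.exp (-((Real.cos (Real.pi / 4 + Real.pi / 2 - θ) ^ 2) / (4 * s 0) + (Real.sin (Real.pi / 4 + Real.pi / 2 - θ) ^ 2) / (4 * s 1))) ∂ν =
            Real.cos θ ^ (-(3 - 2 * Δ)) * g₂ (Real.tan θ ^ 2))) →
    (∀ (g : ℝ → ℝ) (β M₀ : ℝ), Literature.Analysis.SpecialFunctions.IsStieltjesFunction g → 1 ≤ β →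
      (∀ r : ℝ, 0 < r → g (r ^ 2) ≤ M₀ * r ^ (-β)) →
      ∃ F : ℂ → ℂ, DifferentiableOn ℂ F {t : ℂ | 0 < t.re} ∧
        (∀ t : ℝ, 0 < t → F t = ((g (t ^ 2) : ℝ) : ℂ)) ∧
        ∀ t : ℂ, 0 < t.re → ‖F t‖ ≤ M₀ * t.re ^ (-β)) →
    (∀ (K : EuclideanSpace ℝ (Fin 3) → ℝ) (ν : MeasureTheory.Measure (Fin 3 → ℝ)),
      ν {s | ∃ i, s i ≤ 0} = 0 →
      (∀ σ : Equiv.Perm (Fin 3), ν.map (fun s : Fin 3 → ℝ => s ∘ σ) = ν) →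
      (∀ x, x ≠ 0 → MeasureTheory.Integrable (fun s => Real.exp (-∑ i, s i * (x i) ^ 2)) ν ∧
          K x = ∫ s, Real.exp (-∑ i, s i * (x i) ^ 2) ∂ν) →
      MeasureTheory.Integrable (fun s : Fin 3 → ℝ => (s 0 * s 1 * s 2) ^ (-(1/2:ℝ)) * Real.exp (-(((1:ℝ)) / (4 * s 0) + ((0:ℝ)) / (4 * s 1)))) ν →
      MeasureTheory.Integrable (fun s : Fin 3 → ℝ => (s 0 * s 1 * s 2) ^ (-(1/2:ℝ)) * Real.exp (-(((1/2:ℝ)) / (4 * s 0) + ((1/2:ℝ)) / (4 * s 1)))) ν →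
      ∫ s, (s 0 * s 1 * s 2) ^ (-(1/2:ℝ)) * Real.exp (-(((1:ℝ)) / (4 * s 0) + ((0:ℝ)) / (4 * s 1))) ∂ν =
        ∫ s, (s 0 * s 1 * s 2) ^ (-(1/2:ℝ)) * Real.exp (-(((1/2:ℝ)) / (4 * s 0) + ((1/2:ℝ)) / (4 * s 1))) ∂ν →
      ∀ (R : EuclideanSpace ℝ (Fin 3) ≃ₗᵢ[ℝ] EuclideanSpace ℝ (Fin 3)) (x : EuclideanSpace ℝ (Fin 3)), K (R x) = K x) →
    Summit.CriticalPhenomena.Ising3DConformalLimit.Theses.GaussianScaleMixture.GSMRigidity := by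
  intro h1 h2 h3 h4 h5 Δ K hΔ1 hΔ2 _hKc _hKpos hKhom hnine hgsm R x
  -- S1: an exchangeable, `Δ`-homogeneous mixing measure on the open octant
  obtain ⟨ν, hoct, hσf, hex, hhom, hrep⟩ :=
    h1 Δ K (by linarith) hKhom (fun n hn => (hnine n hn).1) hgsm
  -- invariance + RP for the coordinate normal `e₀` and the anti-diagonal normal `e₀ + e₁`
  have hm0 := hnine ((EuclideanSpace.single (0 : Fin 3) (1 : ℝ) : EuclideanSpace ℝ (Fin 3))) ⟨0, 1, by decide, Or.inl rfl⟩
  have hmd := hnine ((EuclideanSpace.single (0 : Fin 3) (1 : ℝ) : EuclideanSpace ℝ (Fin 3)) + (EuclideanSpace.single (1 : Fin 3) (1 : ℝ) : EuclideanSpace ℝ (Fin 3))) ⟨0, 1, by decide, Or.inr (Or.inl rfl)⟩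
  have hmd1 : ∀ y, K (((ℝ ∙ ((Real.sqrt 2 / 2) • ((EuclideanSpace.single (0 : Fin 3) (1 : ℝ) : EuclideanSpace ℝ (Fin 3)) + (EuclideanSpace.single (1 : Fin 3) (1 : ℝ) : EuclideanSpace ℝ (Fin 3)))))ᗮ).reflection y) = K y := fun y => by
    rw [mirrorReflection_smul_normal sqrt_two_div_two_pos.ne']
    exact hmd.1 y
  have hmd2 : IsMirrorRPKernel ((Real.sqrt 2 / 2) • ((EuclideanSpace.single (0 : Fin 3) (1 : ℝ) : EuclideanSpace ℝ (Fin 3)) + (EuclideanSpace.single (1 : Fin 3) (1 : ℝ) : EuclideanSpace ℝ (Fin 3)))) K :=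
    (IsMirrorRPKernel.smul_normal_iff sqrt_two_div_two_pos).2 hmd.2
  -- S2 for the pole `e₀` (offset `e₁`) and for the pole `(e₀+e₁)/√2` (offsets `c (e₁-e₀)/√2`)
  have hP1 := h2 Δ K ν ((EuclideanSpace.single (0 : Fin 3) (1 : ℝ) : EuclideanSpace ℝ (Fin 3))) ((EuclideanSpace.single (1 : Fin 3) (1 : ℝ) : EuclideanSpace ℝ (Fin 3))) hΔ1 hΔ2 hoct hσf hhom hrep norm_e0 e0_apply_two e1_apply_two
    inner_e1_e0 e1_ne_zero hm0.1 hm0.2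
  have hP2 := fun (c : ℝ) (hc : 0 < c) (_hc1 : c ≤ 1) =>
    h2 Δ K ν ((Real.sqrt 2 / 2) • ((EuclideanSpace.single (0 : Fin 3) (1 : ℝ) : EuclideanSpace ℝ (Fin 3)) + (EuclideanSpace.single (1 : Fin 3) (1 : ℝ) : EuclideanSpace ℝ (Fin 3)))) (c • ((Real.sqrt 2 / 2) • ((EuclideanSpace.single (1 : Fin 3) (1 : ℝ) : EuclideanSpace ℝ (Fin 3)) - (EuclideanSpace.single (0 : Fin 3) (1 : ℝ) : EuclideanSpace ℝ (Fin 3))))) hΔ1 hΔ2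
      hoct hσf hhom hrep norm_diagPole diagPole_apply_two (diagOffset_apply_two c)
      (inner_diagOffset_diagPole c) (diagOffset_ne_zero hc) hmd1 hmd2
  -- S3: pole finiteness, continuity, symmetries, traces and growth of the equatorial dual profile
  obtain ⟨hfin, hcont, hsπ, hss1, hss2, g₁, g₂, hg₁, hg₂, ⟨M₀, hM⟩, htr1, htr2⟩ :=
    h3 Δ K ν hΔ1 hΔ2 hoct hσf hex hhom hrep hP1 hP2
  -- S4: half-plane continuation of the two pole pencils, `β = 2a = 3 - 2Δ ∈ [1, 2]`
  have hβ1 : (1 : ℝ) ≤ 3 - 2 * Δ := by linarith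
  obtain ⟨F₁, hF₁d, hF₁eq, hF₁b⟩ := h4 g₁ (3 - 2 * Δ) M₀ hg₁ hβ1 (fun r hr => (hM r hr).1)
  obtain ⟨F₂, hF₂d, hF₂eq, hF₂b⟩ := h4 g₂ (3 - 2 * Δ) M₀ hg₂ hβ1 (fun r hr => (hM r hr).2)
  -- the rigid equator: the profile `ω ↦ D_ν(cos²ω, sin²ω)` is constant
  have hconst := profile_const
    (fun ω : ℝ => ∫ s, (s 0 * s 1 * s 2) ^ (-(1/2:ℝ)) * Real.exp (-((Real.cos ω ^ 2) / (4 * s 0) + (Real.sin ω ^ 2) / (4 * s 1))) ∂ν)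
    (3 - 2 * Δ) M₀ F₁ F₂ (by linarith) (by linarith) hcont hsπ hss1 hss2 hF₁d hF₂d hF₁b hF₂b
    (fun θ h0 h1 => by
      rw [hF₁eq _ (Real.tan_pos_of_pos_of_lt_pi_div_two h0 h1), ← Complex.ofReal_mul, htr1 θ h0 h1])
    (fun θ h0 h1 => by
      rw [hF₂eq _ (Real.tan_pos_of_pos_of_lt_pi_div_two h0 h1), ← Complex.ofReal_mul, htr2 θ h0 h1])
  -- read it at `ω = 0` (the pole `e₀`) and `ω = π/4` (the pole `(e₀+e₁)/√2`): one amplitude identity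
  have key := hconst 0 (Real.pi / 4)
  rw [cos_zero_sq, sin_zero_sq, cos_pi_div_four_sq, sin_pi_div_four_sq] at key
  -- S5: the momentum one-amplitude identity forces `ν ⊂ {s₀ = s₁ = s₂}`, i.e. `K` radial
  exact h5 K ν hoct hex hrep (hfin 1 0 zero_le_one le_rfl (by norm_num))
    (hfin (1 / 2) (1 / 2) (by norm_num) (by norm_num) (by norm_num)) key R x

/-- **The registered stubs discharge the five hypotheses of `GSMRigidity_of` verbatim** (this theorem has no
`sorry` of its own; it depends on the stubs' `sorry`s until they land — then it IS the proof of the crux). -/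
theorem GSMRigidity_of_stubs :
    Summit.CriticalPhenomena.Ising3DConformalLimit.Theses.GaussianScaleMixture.GSMRigidity :=
  GSMRigidity_of stub_mixingMeasureStructure stub_pencilStieltjes stub_dualProfileRegular
    stub_stieltjesHalfPlane stub_oneAmplitudeMomentum

/-- **Remark (kernel-checked `example`, for the lead; deliberately NOT a named declaration).** `GSMRigidity` is
`HyperoctahedralRP.HRP2Rigidity` (stmt-CriticalPhenomena-1979) with one extra hypothesis (the GSM representation), so any
proof of stmt-1979 — e.g. the x-side line `xray-mellin-transfer`, one stub from landing on 2026-08-16 — closes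
stmt-8366 by this one-liner.  Not a stub and not part of the line; recorded so that staffing can weigh it. -/
example :
    Summit.CriticalPhenomena.Ising3DConformalLimit.Theses.HyperoctahedralRP.HRP2Rigidity →
    Summit.CriticalPhenomena.Ising3DConformalLimit.Theses.GaussianScaleMixture.GSMRigidity :=
  fun h Δ K hΔ1 hΔ2 hKc hKp hKhom hnine _ => h Δ K hΔ1 hΔ2 hKc hKp hKhom hnine

/-! ## Check against the landed Negative lemmas (no stub is an instance they refute) -/
section NegativeScratch
open Summit.CriticalPhenomena.Ising3DConformalLimit.Theorems.GSMRigidity.Negative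

-- RP is load-bearing and enters this line at S2 only: the exchangeable three-atom GSM is anisotropic and not swap-RP,
example : ¬ IsMirrorRPKernel nSwap threeAtomKernel := threeAtomKernel_not_swapRP
-- and so is the planner family at `ε = 1/2, 1/5` (no stub asserts RP of any GSM kernel; S2 ASSUMES it):
example : ¬ IsMirrorRPKernel nSwap (plannerKernel (1 / 2)) := plannerKernel_half_not_swapRP
example : ¬ IsMirrorRPKernel nSwap (plannerKernel (1 / 5)) := plannerKernel_fifth_not_swapRP
-- the crux minus RP is false, so S1 + S3 + S4 + S5 (all RP-free) cannot close it without S2: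
example := @not_gsmRigidity_without_RP
-- the disprover's positive-side tool of the OTHER line (arc jump), imported only to certify coexistence:
example := @jump_positivity

end NegativeScratch

end Summit.CriticalPhenomena.Ising3DConformalLimit.Cruxes.GSMRigidity.MomentumOneAmplitude
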